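import Mathlib
import HarnessLib
import Literature.MathematicalPhysics.QuantumFieldTheory.WilsonFlow
import Summits.Ventures.LatticeQCDFlow.Exactness.KernelCouplingMask
import Summits.Ventures.LatticeQCDFlow.Exactness.SUNStoutLayerEquivariance
import Summits.Ventures.LatticeQCDFlow.Exactness.GaugeFieldTranslationInvariance
import Summits.Ventures.LatticeQCDFlow.Exactness.EquivariantJacobianGaugeInvariance

/-!
# Kernel coupling layers, the engine's masks and the `SU(N)` stout layer under LATTICE TRANSLATIONS; translation-equivariant layers have translation-invariant exact Jacobians

HONEST FRAMING: exact (Metropolis-corrected) sampling algorithms for lattice gauge theory;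
figures of merit are autocorrelation/cost numbers at stated couplings and volumes; no
continuum-physics claim.

Venture `LatticeQCDFlow` (cell pub-lqcd), topic `Exactness`; FANOUT row 10 (`eng-equiv`, engine
`latflow.equiv` / `latflow.flows_jax`: `masks.py` "phase(x) = (Σ_ν shifts[ν]·x_ν) mod width",
`u1.py` / `spectral.py` kernel coupling layers, `residual.py` stout layers, `nn.py` "periodic
roll+GEMM CNNs"; acceptance suite `tests/test_flows_jax.py`: "translation covariance 0.0e+00" of
the Kanwar-2020 `U(1)` preset and of the `SU(N)` presets after `transfer`).  NEW WORK of the cell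
over `KernelCouplingGaugeEquivariance` / `KernelCouplingMask` (the layer
`V e ↦ h(V,e)(P) · P⁻¹ · V e` on active links, direction masks `e.2 = μ ∧ φ e.1 = c`),
`SUNStoutLayerEquivariance` (the masked stout layer `V e ↦ exp(ρ(V,e) • 𝒫(Ω_e(V))) · V e`), the
tree's `GaugeConfig.siteTranslate` / `plaquetteHolonomy_siteTranslate` /
`plaquetteLoopSum_siteTranslate` (`WilsonFlow`), row 14's `measurePreserving_translate_pi`
(`GaugeFieldTranslationInvariance`) and `HasJacobian.jac_comp_symm_ae_eq` / `jac_comp_symm_eq`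
(`EquivariantJacobianGaugeInvariance`).  Nothing is cited as a fact; no number; no definition is
introduced.  Row 14 typed translation covariance of ITS members (`SU2WilsonFlowLOTranslation`,
`SU2ResidualMemberTranslation`, `U1WilsonFlowLOTranslation`) and consumes, for any member `F`,
the two hypotheses `F (V·t) = (F V)·t` and `J (V·t) = J V` (`u1_fthmc_conjKernel_translate`,
`su2_fthmc_conjKernel_translate`); this file supplies them for row 10's coupling layers, every
group, every `d`, `L`.  A translation `t : Site d L` acts by `(V·t)(x, μ) = V(x + t, μ)`
(`GaugeConfig.siteTranslate t V`).

## What is typed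

* **`kernelLayer_siteTranslate`** (any group, any loop field `P`, any kernel `h`) — if the loop
  field and the kernel data are translation COVARIANT on active links (`P(V·t, e) = P(V, e + t)`,
  `h(V·t, e) = h(V, e + t)`: the defining property of a convolutional conditioner reading the
  frozen links around the ACTIVE link) and the masks correspond (`p e ↔ p' (e + t)`), the layer
  with mask `p` applied to `V·t` is the translate of the layer with mask `p'` applied to `V`;
  `kernelLayer_siteTranslate_of_invariant_mask` — a `t`-invariant mask gives
  `F (V·t) = (F V)·t` verbatim; **`plaquetteKernelLayer_siteTranslate`** — the plaquette kernel
  layer of `isGaugeEquivariant_plaquetteKernelLayer` (plane choice `ν` `t`-periodic), where the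
  loop field's covariance IS `plaquetteHolonomy_siteTranslate`;
* the engine's direction masks under translations: **`directionMask_siteTranslate`** — translating
  by `t` carries the mask of phase `c` to the mask of phase `c + φ(t)` of the SAME family (so a
  translate of a layer of the cycle is again a layer of the cycle), `directionMask_siteTranslate_of_ker`
  — translations with `φ(t) = 0` preserve every mask, and `stripesPhase_apply_eq_zero` — for the
  engine's phase `φ x = Σ_ρ s_ρ (x_ρ mod w)` (`w ∣ L`) every translation by multiples of the width
  in all directions has `φ(t) = 0` (stripes / checker / gen-checker: the flow commutes with the
  sublattice `wℤ^d` of translations, `w = 4`);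
* **`sunStoutLayer_siteTranslate`** — the masked `SU(N)` stout layer with translation-covariant
  coefficients `ρ(V·t, e) = ρ(V, e + t)` intertwines translations in the same way (every `N`);
  `foldr_comp_siteTranslate` — a schedule of layers each commuting with `Θ_t` commutes with `Θ_t`
  (flow level, the composition convention of `SUNStoutScheduleClassFunction`);
* **`HasJacobian.jac_siteTranslate_ae_eq`** — for ANY σ-finite one-link law `μ` and any measurable
  automorphism `F` of `G^E` with `F (V·t) = (F V)·t`, every exact Jacobian `J` of `F` for `⊗_e μ`
  satisfies `J (V·t) = J V` for `⊗_e μ`-a.e. `V` (two exact Jacobians of one automorphism agree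
  a.e.; `J ∘ Θ_t` is one because `Θ_t` preserves `⊗_e μ`); **`HasJacobian.jac_siteTranslate_eq`**
  — EVERYWHERE for a continuous `j ≥ 0` and product Haar of a compact second-countable group: the
  hypothesis `hJ` of row 14's translation theorems follows from `hF` for every booked continuous
  Jacobian.

NOT here: which conditioner the engine trains (translation covariance of a periodic CNN's outputs
is the hypothesis `hh` / `hρ`, an engineering fact about `nn.py`, not typed); translations that
permute the masks of a cycle into a different ORDER (only `φ(t) = 0` and the single-layer
intertwining are typed); location / alternate geometries (other `(p, ν)`; the same lemma once their
plane choice is `t`-periodic); any number.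
-/

noncomputable section

namespace Summit.Ventures.LatticeQCDFlow.Exactness

open MeasureTheory
open Literature.MathematicalPhysics.QuantumFieldTheory
open scoped ENNReal

variable {d L : ℕ}

/-! ## Kernel coupling layers intertwine lattice translations (any group) -/

section AnyGroup

variable {G : Type*} [Group G]

/-- **Kernel coupling layers intertwine lattice translations.**  Two layers of the SAME architecture
(loop field `P`, kernel `h`) with masks `p`, `p'` related by `p e ↔ p' (e + t)`; the loop field and
the kernel translation covariant on the active links of `p`.  Then the `p`-layer applied to the
translated configuration `V·t` is the translate of the `p'`-layer applied to `V`. -/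
theorem kernelLayer_siteTranslate (p p' : Edge d L → Prop) [DecidablePred p] [DecidablePred p']
    (t : Site d L) (P : GaugeConfig d L G → Edge d L → G) (h : GaugeConfig d L G → Edge d L → G → G)
    (F F' : GaugeConfig d L G → GaugeConfig d L G)
    (hF : ∀ V e, F V e = if p e then h V e (P V e) * (P V e)⁻¹ * V e else V e)
    (hF' : ∀ V e, F' V e = if p' e then h V e (P V e) * (P V e)⁻¹ * V e else V e)
    (hp : ∀ e : Edge d L, p e ↔ p' (e.1 + t, e.2))
    (hP : ∀ (V : GaugeConfig d L G) (e : Edge d L), p e →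
      P (GaugeConfig.siteTranslate t V) e = P V (e.1 + t, e.2))
    (hh : ∀ (V : GaugeConfig d L G) (e : Edge d L), p e →
      h (GaugeConfig.siteTranslate t V) e = h V (e.1 + t, e.2))
    (V : GaugeConfig d L G) :
    F (GaugeConfig.siteTranslate t V) = GaugeConfig.siteTranslate t (F' V) := by
  funext e
  rw [hF, GaugeConfig.siteTranslate_apply, GaugeConfig.siteTranslate_apply, hF']
  by_cases he : p e
  · rw [if_pos he, if_pos ((hp e).1 he), hP V e he, hh V e he]
  · rw [if_neg he, if_neg (fun he' => he ((hp e).2 he'))]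

/-- **A translation preserving the mask commutes with the layer**: `F (V·t) = (F V)·t` — the shape of
the hypothesis `hF` of row 14's `*_fthmc_conjKernel_translate`. -/
theorem kernelLayer_siteTranslate_of_invariant_mask (p : Edge d L → Prop) [DecidablePred p]
    (t : Site d L) (P : GaugeConfig d L G → Edge d L → G) (h : GaugeConfig d L G → Edge d L → G → G)
    (F : GaugeConfig d L G → GaugeConfig d L G)
    (hF : ∀ V e, F V e = if p e then h V e (P V e) * (P V e)⁻¹ * V e else V e)
    (hp : ∀ e : Edge d L, p e ↔ p (e.1 + t, e.2))
    (hP : ∀ (V : GaugeConfig d L G) (e : Edge d L), p e →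
      P (GaugeConfig.siteTranslate t V) e = P V (e.1 + t, e.2))
    (hh : ∀ (V : GaugeConfig d L G) (e : Edge d L), p e →
      h (GaugeConfig.siteTranslate t V) e = h V (e.1 + t, e.2))
    (V : GaugeConfig d L G) :
    F (GaugeConfig.siteTranslate t V) = GaugeConfig.siteTranslate t (F V) :=
  kernelLayer_siteTranslate p p t P h F F hF hF hp hP hh V

/-- **The plaquette kernel coupling layer intertwines lattice translations** (the layer of
`isGaugeEquivariant_plaquetteKernelLayer`, plane choice `ν` periodic under `t`, kernel data
translation covariant): here the loop field's covariance is the tree's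
`plaquetteHolonomy_siteTranslate`. -/
theorem plaquetteKernelLayer_siteTranslate (p p' : Edge d L → Prop) [DecidablePred p] [DecidablePred p']
    (t : Site d L) (ν : Edge d L → Fin d) (hν : ∀ e : Edge d L, ν (e.1 + t, e.2) = ν e)
    (h : GaugeConfig d L G → Edge d L → G → G)
    (hp : ∀ e : Edge d L, p e ↔ p' (e.1 + t, e.2))
    (hh : ∀ (V : GaugeConfig d L G) (e : Edge d L), p e →
      h (GaugeConfig.siteTranslate t V) e = h V (e.1 + t, e.2))
    (V : GaugeConfig d L G) :
    (fun e : Edge d L =>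
        if p e then
          h (GaugeConfig.siteTranslate t V) e
              (plaquetteHolonomy (GaugeConfig.siteTranslate t V) e.1 e.2 (ν e)) *
            (plaquetteHolonomy (GaugeConfig.siteTranslate t V) e.1 e.2 (ν e))⁻¹ *
              GaugeConfig.siteTranslate t V e
        else GaugeConfig.siteTranslate t V e) =
      GaugeConfig.siteTranslate t (fun e : Edge d L =>
        if p' e then h V e (plaquetteHolonomy V e.1 e.2 (ν e)) * (plaquetteHolonomy V e.1 e.2 (ν e))⁻¹ * V e
        else V e) :=
  kernelLayer_siteTranslate p p' t (fun W e => plaquetteHolonomy W e.1 e.2 (ν e)) h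
    (fun W e => if p e then h W e (plaquetteHolonomy W e.1 e.2 (ν e)) * (plaquetteHolonomy W e.1 e.2 (ν e))⁻¹ * W e
      else W e)
    (fun W e => if p' e then h W e (plaquetteHolonomy W e.1 e.2 (ν e)) * (plaquetteHolonomy W e.1 e.2 (ν e))⁻¹ * W e
      else W e)
    (fun _ _ => rfl) (fun _ _ => rfl) hp
    (fun W e _ => by
      show plaquetteHolonomy (GaugeConfig.siteTranslate t W) e.1 e.2 (ν e) =
        plaquetteHolonomy W (e.1 + t) e.2 (ν (e.1 + t, e.2))
      rw [plaquetteHolonomy_siteTranslate, hν])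
    hh V

end AnyGroup

/-! ## The engine's direction masks under translations -/

section Masks

variable {A : Type*} [AddGroup A]

/-- **Translating a direction mask shifts its phase by `φ(t)`**: `e` is active for phase `c` iff
`e + t` is active for phase `c + φ(t)` — the translate of a layer of the masking cycle is a layer
of the same cycle (the shape of the hypothesis `hp` of `kernelLayer_siteTranslate`). -/
theorem directionMask_siteTranslate (φ : (Fin d → ZMod L) →+ A) (c : A) (μ : Fin d) (t : Site d L)
    (e : Edge d L) :
    (e.2 = μ ∧ φ e.1 = c) ↔ ((e.1 + t, e.2).2 = μ ∧ φ (e.1 + t, e.2).1 = c + φ t) := by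
  show (e.2 = μ ∧ φ e.1 = c) ↔ (e.2 = μ ∧ φ (e.1 + t) = c + φ t)
  rw [map_add, add_left_inj]

/-- **Translations in the kernel of the phase preserve every mask of the cycle.** -/
theorem directionMask_siteTranslate_of_ker (φ : (Fin d → ZMod L) →+ A) (c : A) (μ : Fin d)
    {t : Site d L} (ht : φ t = 0) (e : Edge d L) :
    (e.2 = μ ∧ φ e.1 = c) ↔ ((e.1 + t, e.2).2 = μ ∧ φ (e.1 + t, e.2).1 = c) := by
  have h := directionMask_siteTranslate φ c μ t e
  rwa [ht, add_zero] at h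

/-- **The engine's phase vanishes on the width sublattice**: for `φ x = Σ_ρ s_ρ · (x_ρ mod w)`
(`w ∣ L`; `stripes`, `checker`, `gen-checker`), every translation `t` with all components
`≡ 0 mod w` has `φ(t) = 0` — so by `directionMask_siteTranslate_of_ker` it preserves every mask
of the cycle, and by `kernelLayer_siteTranslate_of_invariant_mask` it commutes with every layer. -/
theorem stripesPhase_apply_eq_zero {w : ℕ} (hw : w ∣ L) (s : Fin d → ZMod w) (t : Site d L)
    (ht : ∀ ρ : Fin d, ZMod.castHom hw (ZMod w) (t ρ) = 0) :
    (∑ ρ : Fin d, (AddMonoidHom.mulLeft (s ρ)).comp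
        (((ZMod.castHom hw (ZMod w)).toAddMonoidHom).comp (Pi.evalAddMonoidHom (fun _ => ZMod L) ρ))) t = 0 := by
  rw [AddMonoidHom.finsetSum_apply]
  refine Finset.sum_eq_zero fun ρ _ => ?_
  simp [ht ρ]

end Masks

/-! ## The masked `SU(N)` stout layer -/

section Stout

variable {n : ℕ}

/-- **The masked `SU(N)` stout layer intertwines lattice translations** (the layer of
`isGaugeEquivariant_sunStoutLayer`; coefficients translation covariant on active links, masks
related by `p e ↔ p' (e + t)`): the covariance of the loop sum is the tree's
`plaquetteLoopSum_siteTranslate`. -/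
theorem sunStoutLayer_siteTranslate (p p' : Edge d L → Prop) [DecidablePred p] [DecidablePred p']
    (t : Site d L)
    (ρ : GaugeConfig d L (Matrix.specialUnitaryGroup (Fin n) ℂ) → Edge d L → ℝ)
    (hp : ∀ e : Edge d L, p e ↔ p' (e.1 + t, e.2))
    (hρ : ∀ (V : GaugeConfig d L (Matrix.specialUnitaryGroup (Fin n) ℂ)) (e : Edge d L), p e →
      ρ (GaugeConfig.siteTranslate t V) e = ρ V (e.1 + t, e.2))
    (V : GaugeConfig d L (Matrix.specialUnitaryGroup (Fin n) ℂ)) :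
    (fun e : Edge d L =>
        if p e then
          (⟨NormedSpace.exp ((ρ (GaugeConfig.siteTranslate t V) e : ℂ) •
                suProj (plaquetteLoopSum (GaugeConfig.siteTranslate t V) e.1 e.2)),
              exp_smul_suProj_mem (ρ (GaugeConfig.siteTranslate t V) e)
                (plaquetteLoopSum (GaugeConfig.siteTranslate t V) e.1 e.2)⟩ :
              Matrix.specialUnitaryGroup (Fin n) ℂ) * GaugeConfig.siteTranslate t V e
        else GaugeConfig.siteTranslate t V e) =
      GaugeConfig.siteTranslate t (fun e : Edge d L =>
        if p' e then
          (⟨NormedSpace.exp ((ρ V e : ℂ) • suProj (plaquetteLoopSum V e.1 e.2)),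
              exp_smul_suProj_mem (ρ V e) (plaquetteLoopSum V e.1 e.2)⟩ :
              Matrix.specialUnitaryGroup (Fin n) ℂ) * V e
        else V e) := by
  funext e
  rw [GaugeConfig.siteTranslate_apply, GaugeConfig.siteTranslate_apply]
  by_cases he : p e
  · rw [if_pos he, if_pos ((hp e).1 he), hρ V e he, plaquetteLoopSum_siteTranslate]
  · rw [if_neg he, if_neg (fun he' => he ((hp e).2 he'))]

end Stout

/-! ## Flows: schedules of translation-equivariant layers -/

section Flow

variable {G : Type*} {ι : Type*}

/-- **A schedule of layers each commuting with `Θ_t` commutes with `Θ_t`** (composition convention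
of `SUNStoutScheduleClassFunction.isGaugeEquivariant_foldr_comp`): with
`directionMask_siteTranslate_of_ker` / `stripesPhase_apply_eq_zero`, every translation of the width
sublattice commutes with a whole masking cycle of kernel / stout layers. -/
theorem foldr_comp_siteTranslate (t : Site d L) (F : ι → GaugeConfig d L G → GaugeConfig d L G)
    (hF : ∀ i V, F i (GaugeConfig.siteTranslate t V) = GaugeConfig.siteTranslate t (F i V))
    (sched : List ι) (V : GaugeConfig d L G) :
    (sched.foldr (fun i (H : GaugeConfig d L G → GaugeConfig d L G) => H ∘ F i) id)
        (GaugeConfig.siteTranslate t V) =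
      GaugeConfig.siteTranslate t
        ((sched.foldr (fun i (H : GaugeConfig d L G → GaugeConfig d L G) => H ∘ F i) id) V) := by
  induction sched generalizing V with
  | nil => rfl
  | cons i rest ih =>
    simp only [List.foldr_cons, Function.comp_apply]
    rw [hF i V, ih]

end Flow

/-! ## Translation-equivariant layers have translation-invariant exact Jacobians -/

section Jacobian

variable [NeZero L] {G : Type*} [MeasurableSpace G]

omit [NeZero L] in
/-- The lattice translation by `t` as a measurable automorphism of `G^E` (inverse: translation by
`−t`). -/
theorem exists_measurableEquiv_siteTranslate (t : Site d L) :
    ∃ T : GaugeConfig d L G ≃ᵐ GaugeConfig d L G, ⇑T = GaugeConfig.siteTranslate t := by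
  refine ⟨{ toFun := GaugeConfig.siteTranslate t
            invFun := GaugeConfig.siteTranslate (-t)
            left_inv := fun V => funext fun e => by
              simp only [GaugeConfig.siteTranslate_apply, neg_add_cancel_right]
            right_inv := fun V => funext fun e => by
              simp only [GaugeConfig.siteTranslate_apply, add_neg_cancel_right]
            measurable_toFun := measurable_pi_lambda _ fun e => measurable_pi_apply _
            measurable_invFun := measurable_pi_lambda _ fun e => measurable_pi_apply _ }, rfl⟩

/-- **Exact Jacobians of a translation-equivariant automorphism are translation invariant almost
everywhere** — ANY σ-finite one-link law `μ` (any measurable group or space), any measurable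
automorphism `F` of `G^E` with `F (V·t) = (F V)·t`, any exact Jacobian `J` of `F` for `⊗_e μ`. -/
theorem HasJacobian.jac_siteTranslate_ae_eq (μ : Measure G) [SigmaFinite μ] (t : Site d L)
    {F : GaugeConfig d L G ≃ᵐ GaugeConfig d L G}
    (hF : ∀ V : GaugeConfig d L G, F (GaugeConfig.siteTranslate t V) = GaugeConfig.siteTranslate t (F V))
    {J : GaugeConfig d L G → ℝ≥0∞} (h : HasJacobian (Measure.pi fun _ : Edge d L => μ) F J) :
    ∀ᵐ V ∂(Measure.pi fun _ : Edge d L => μ), J (GaugeConfig.siteTranslate t V) = J V := by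
  obtain ⟨T, hT⟩ := exists_measurableEquiv_siteTranslate (G := G) (d := d) (L := L) t
  have hTp : MeasurePreserving T (Measure.pi fun _ : Edge d L => μ) (Measure.pi fun _ : Edge d L => μ) := by
    rw [show (T : GaugeConfig d L G → GaugeConfig d L G) = GaugeConfig.siteTranslate t from hT]
    exact measurePreserving_translate_pi μ t
  have hcomm : ∀ V, F (T V) = T (F V) := fun V => by rw [hT]; exact hF V
  have hae := h.jac_comp_symm_ae_eq T hTp hcomm
  filter_upwards [hae] with V hV
  rw [Function.comp_apply, hT] at hV
  exact hV

omit [MeasurableSpace G] in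
/-- **… and EVERYWHERE for a continuous Jacobian**: `G` a compact second-countable group with its
Haar probability, `j ≥ 0` continuous with `HasJacobian (⊗_e Haar) F (ofReal ∘ j)` and
`F (V·t) = (F V)·t` give `j (V·t) = j V` for every `V` — the hypothesis `hJ` of row 14's
`*_fthmc_conjKernel_translate` for every booked continuous Jacobian of a translation-equivariant
member. -/
theorem HasJacobian.jac_siteTranslate_eq [Group G] [TopologicalSpace G] [IsTopologicalGroup G]
    [CompactSpace G] [SecondCountableTopology G] [MeasurableSpace G] [BorelSpace G] (t : Site d L)
    {F : GaugeConfig d L G ≃ᵐ GaugeConfig d L G}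
    (hF : ∀ V : GaugeConfig d L G, F (GaugeConfig.siteTranslate t V) = GaugeConfig.siteTranslate t (F V))
    {j : GaugeConfig d L G → ℝ} (hj : Continuous j) (hj0 : ∀ V, 0 ≤ j V)
    (h : HasJacobian (Measure.pi fun _ : Edge d L => haarProbability G) F (fun V => ENNReal.ofReal (j V)))
    (V : GaugeConfig d L G) : j (GaugeConfig.siteTranslate t V) = j V := by
  haveI : (haarProbability G).IsOpenPosMeasure := by unfold haarProbability; infer_instance
  obtain ⟨T, hT⟩ := exists_measurableEquiv_siteTranslate (G := G) (d := d) (L := L) t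
  have hTp : MeasurePreserving T (Measure.pi fun _ : Edge d L => haarProbability G)
      (Measure.pi fun _ : Edge d L => haarProbability G) := by
    rw [show (T : GaugeConfig d L G → GaugeConfig d L G) = GaugeConfig.siteTranslate t from hT]
    exact measurePreserving_translate_pi (haarProbability G) t
  have hTc : Continuous T := by
    rw [hT]
    exact continuous_pi fun e => continuous_apply _
  have hcomm : ∀ W, F (T W) = T (F W) := fun W => by rw [hT]; exact hF W
  have h1 := HasJacobian.jac_comp_symm_eq hj h T hTp hTc hcomm V
  rw [hT] at h1
  exact (ENNReal.ofReal_eq_ofReal_iff (hj0 _) (hj0 _)).1 h1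

end Jacobian

end Summit.Ventures.LatticeQCDFlow.Exactness

end
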